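import Summits.Ventures.PercRepro.C041RelaxedTriangleMain
import Summits.Ventures.PercRepro.C041CycleArcModel

/-!
# THE RELAXED DOMAIN IS CLOSED UNDER THE TRIANGLE MAP; (P) ON EVERY TWO-EXIT CYCLE WITH CONE INPUTS
(mine-3, gen 59; C-041.md §21 (m), (r), (t))

PART 1 — THE RELAXED THEOREM ITERATES.  THEOREM (RELAXED TRIANGLE) gives (P) at the triangle's output; here the TRIVIAL
BOUNDS `0 ≤ I_F ≤ F`, `0 ≤ I₁ ≤ T₁`, `0 ≤ I₂ ≤ T₂` hold at the output as well (`Triv_thetaTri_of_rel`), so `Rel` — (P) + the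
trivial bounds — is CLOSED under `thetaTri` (`Rel_thetaTri_of_rel`), and under sums and scaling (`Rel_add`, `Rel_smul`).
In the parametrisation `F = σ + I_F + I₁ + I₂`, `T₁ = I₁ + V₁`, `T₂ = I₂ + V₂` of a relaxed zone by twelve non-negative numbers
(`sixV`; `V_t` = the valid type-`t` states), each of the six output bounds is a polynomial with NON-NEGATIVE coefficients
(16 / 35 / 16 / 18 / 16 / 18 monomials; mining/mine-3/tools/g59/polyout59.py), so `positivity` proves it after `ring_nf`.
CONSEQUENCE: (P), the one-anchor (CS) and the ZONE O-CUBE hold on every NESTED two-exit block structure — a triangle whose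
exits carry triangles whose exits carry … — with arbitrary relaxed-feasible zones at the leaves (`K4v_thetaTri_iter`).

PART 2 — THE CYCLE WITH CONE INPUTS.  THEOREM (`K4v_thetaCyc_of_InCone`): for cone members `w`, `w′` and `p, q, s ≥ 0` the
cycle of `C041CycleArcModel` satisfies (P) — the triangle part by THEOREM (RELAXED TRIANGLE) for cone inputs, every other
part a cone member; in particular (`K4v_thetaCyc_marks`, `K4v_thetaCyc_lengths`) for two marked vertices with arbitrary
marks on a cycle of arbitrary length and positions — THEOREM (CYCLES WITH TWO MARKED VERTICES) of C-041.md §21 (m) on the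
arc-type model; the output is relaxed-feasible (`Rel_thetaCyc_of_InCone`), so a cycle can sit below a triangle, and two
nested cycles with (1,1)-vertices at the leaves satisfy (P) (`K4v_thetaCyc_nested_X11`).
-/

namespace PercRepro

namespace RelaxedTriangle

open TreeClosure

/-! ## Part 1: the relaxed domain is closed under the triangle map -/

/-- A relaxed zone by its twelve-free parametrisation: `σ`, `I_F`, `I₁`, `I₂`, `V₁`, `V₂` (all `≥ 0`), with
`F = σ + I_F + I₁ + I₂`, `T₁ = I₁ + V₁`, `T₂ = I₂ + V₂`. -/
def sixV (s J I1 I2 V1 V2 : ℝ) : Vec6 :=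
  ![s + J + I1 + I2, s + J + I1 + I2 + (I1 + V1), s + J + I1 + I2 + (I2 + V2), J, J + I1, J + I2]

/-- Every six-vector is `sixV` of its zone parameters. -/
theorem sixV_self (w : Vec6) :
    sixV (w 0 - (w 4 + w 5 - w 3)) (w 3) (w 4 - w 3) (w 5 - w 3) ((w 1 - w 0) - (w 4 - w 3))
      ((w 2 - w 0) - (w 5 - w 3)) = w := by
  ext i
  simp only [sixV]
  fin_cases i <;> simp <;> ring

/-- The trivial bounds at the triangle's output, in the parametrisation: every bound is a positive-coefficient
polynomial in the twelve parameters. -/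
theorem Triv_thetaTri_sixV (s J I1 I2 V1 V2 s' J' I1' I2' V1' V2' : ℝ) (hs : 0 ≤ s) (hJ : 0 ≤ J) (hI1 : 0 ≤ I1)
    (hI2 : 0 ≤ I2) (hV1 : 0 ≤ V1) (hV2 : 0 ≤ V2) (hs' : 0 ≤ s') (hJ' : 0 ≤ J') (hI1' : 0 ≤ I1') (hI2' : 0 ≤ I2')
    (hV1' : 0 ≤ V1') (hV2' : 0 ≤ V2') :
    Triv (thetaTri (sixV s J I1 I2 V1 V2) (sixV s' J' I1' I2' V1' V2')) := by
  refine ⟨?_, ?_, ?_, ?_, ?_, ?_⟩ <;> simp [thetaTri_eq_vec, sixV] <;> rw [← sub_nonneg] <;> ring_nf <;> positivity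

/-- The trivial bounds hold at the output of the relaxed triangle. -/
theorem Triv_thetaTri_of_rel {w w' : Vec6} (hw : Rel w) (hw' : Rel w') : Triv (thetaTri w w') := by
  obtain ⟨hk, h3, h4, h5, h6, h7⟩ := hw
  obtain ⟨hk', h3', h4', h5', h6', h7'⟩ := hw'
  obtain ⟨_, _, _, k4, _⟩ := hk
  obtain ⟨_, _, _, k4', _⟩ := hk'
  rw [← sixV_self w, ← sixV_self w']
  exact Triv_thetaTri_sixV _ _ _ _ _ _ _ _ _ _ _ _ (by linarith) h3 h4 h6 (by linarith) (by linarith)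
    (by linarith) h3' h4' h6' (by linarith) (by linarith)

/-- **The relaxed domain is closed under the triangle map**: `Rel w → Rel w′ → Rel (thetaTri w w′)`. -/
theorem Rel_thetaTri_of_rel {w w' : Vec6} (hw : Rel w) (hw' : Rel w') : Rel (thetaTri w w') :=
  let t := Triv_thetaTri_of_rel hw hw'
  ⟨K4v_thetaTri_of_rel hw hw', t.iF_nonneg, t.i1_nonneg, t.i1_le, t.i2_nonneg, t.i2_le⟩

/-- The two-level instance: a triangle whose two exits carry triangles with relaxed-feasible zones satisfies (P). -/
theorem K4v_thetaTri_iter {w₁ w₂ w₃ w₄ : Vec6} (h₁ : Rel w₁) (h₂ : Rel w₂) (h₃ : Rel w₃) (h₄ : Rel w₄) :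
    K4v (thetaTri (thetaTri w₁ w₂) (thetaTri w₃ w₄)) :=
  K4v_thetaTri_of_rel (Rel_thetaTri_of_rel h₁ h₂) (Rel_thetaTri_of_rel h₃ h₄)


/-- `Rel` is closed under sums. -/
theorem Rel_add {x y : Vec6} (hx : Rel x) (hy : Rel y) : Rel (x + y) := by
  obtain ⟨kx, a1, a3, a4, a5, a6⟩ := hx
  obtain ⟨ky, b1, b3, b4, b5, b6⟩ := hy
  refine ⟨K4v_add kx ky, ?_, ?_, ?_, ?_, ?_⟩ <;> simp only [Pi.add_apply] <;> linarith

/-- `Rel` is closed under non-negative scaling. -/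
theorem Rel_smul {x : Vec6} (hx : Rel x) {c : ℝ} (hc : 0 ≤ c) : Rel (c • x) := by
  obtain ⟨kx, a1, a3, a4, a5, a6⟩ := hx
  refine ⟨K4v_smul kx hc, ?_, ?_, ?_, ?_, ?_⟩ <;> simp only [Pi.smul_apply, smul_eq_mul] <;>
    nlinarith [mul_nonneg hc a1, mul_nonneg hc a3, mul_nonneg hc (sub_nonneg.2 a4), mul_nonneg hc a5,
      mul_nonneg hc (sub_nonneg.2 a6)]

/-! ## Part 2: (P) on the cycle with cone inputs -/

/-- **THEOREM (CYCLES WITH TWO EXITS, cone inputs)**: for cone members `w`, `w′` at the two exits and any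
multiplicities `p, q, s ≥ 0`, the cycle satisfies (P). -/
theorem K4v_thetaCyc_of_InCone {w w' : Vec6} (hw : InCone w) (hw' : InCone w') {p q s : ℝ} (hp : 0 ≤ p)
    (hq : 0 ≤ q) (hs : 0 ≤ s) : K4v (thetaCyc p q s w w') := by
  rw [thetaCyc_eq]
  have h1 : K4v (thetaTri w w') := K4v_thetaTri_of_InCone hw hw'
  have h2 : InCone (ellv (ellv w * w')) := InCone_ellv ((InCone_ellv hw).mul hw')
  have h3 : InCone (ellv (w * ellv w')) := InCone_ellv (hw.mul (InCone_ellv hw'))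
  have hn : 0 ≤ nAdm w := nAdm_nonneg_of_K4v (K4v_of_InCone hw)
  have hn' : 0 ≤ nAdm w' := nAdm_nonneg_of_K4v (K4v_of_InCone hw')
  have hnn : 0 ≤ nAdm (w * w') := nAdm_nonneg_of_K4v (K4v_of_InCone (hw.mul hw'))
  have h4 : InCone ((p * s * (nAdm w * nAdm w' + nAdm (w * w'))) • (1 : Vec6)) :=
    InCone.smul _ (mul_nonneg (mul_nonneg hp hs) (add_nonneg (mul_nonneg hn hn') hnn)) InCone_one
  have h5 : InCone ((ellv w + (p * nAdm w) • (1 : Vec6)) * (ellv w' + (s * nAdm w') • (1 : Vec6))) :=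
    ((InCone_ellv hw).add (InCone.smul _ (mul_nonneg hp hn) InCone_one)).mul
      ((InCone_ellv hw').add (InCone.smul _ (mul_nonneg hs hn') InCone_one))
  exact K4v_add (K4v_add (K4v_add (K4v_add h1 (K4v_smul (K4v_of_InCone h2) hp))
    (K4v_smul (K4v_of_InCone h3) hs)) (K4v_of_InCone h4)) (K4v_smul (K4v_of_InCone h5) hq)

/-- The ZONE O-CUBE on the cycle with two cone-member exits. -/
theorem zoneOCube_thetaCyc_of_InCone {w w' : Vec6} (hw : InCone w) (hw' : InCone w') {p q s : ℝ} (hp : 0 ≤ p)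
    (hq : 0 ≤ q) (hs : 0 ≤ s) :
    0 ≤ (thetaCyc p q s w w' 1 - thetaCyc p q s w w' 0) + (thetaCyc p q s w w' 2 - thetaCyc p q s w w' 0)
      + 2 * (thetaCyc p q s w w' 4 + thetaCyc p q s w w' 5 - thetaCyc p q s w w' 3) - 2 * thetaCyc p q s w w' 0 :=
  zoneOCube_nonneg_of_K4 (K4v_thetaCyc_of_InCone hw hw' hp hq hs)

/-- **THEOREM (CYCLES WITH TWO MARKED VERTICES)** on the arc-type model: two marked vertices with `p₁`, `q₁` and
`p₂`, `q₂` marks of the two types (`X(p, q) = v 1 ^ p * v 0 ^ q`), any multiplicities `p, q, s ≥ 0`. -/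
theorem K4v_thetaCyc_marks (p₁ q₁ p₂ q₂ : ℕ) {p q s : ℝ} (hp : 0 ≤ p) (hq : 0 ≤ q) (hs : 0 ≤ s) :
    K4v (thetaCyc p q s (v 1 ^ p₁ * v 0 ^ q₁) (v 1 ^ p₂ * v 0 ^ q₂)) :=
  K4v_thetaCyc_of_InCone ((InCone_pow_v_one p₁).mul (InCone_pow_v_zero q₁))
    ((InCone_pow_v_one p₂).mul (InCone_pow_v_zero q₂)) hp hq hs

/-- The multiplicity `2^ℓ − 2` of a mixed arc of length `ℓ ≥ 1` is non-negative. -/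
theorem mixed_mult_nonneg (l : ℕ) (hl : 1 ≤ l) : (0 : ℝ) ≤ 2 ^ l - 2 := by
  have : (2 : ℝ) ^ 1 ≤ 2 ^ l := pow_le_pow_right₀ (by norm_num) hl
  linarith

/-- **THEOREM (CYCLES WITH TWO MARKED VERTICES), actual cycles**: arcs of lengths `l₁, l₂, l₃ ≥ 1` (so `m = l₁ + l₂ + l₃ ≥ 3`,
the exits at positions `l₁` and `l₁ + l₂`), mixed multiplicities `2^l − 2`, two cone-member exits. -/
theorem K4v_thetaCyc_lengths {w w' : Vec6} (hw : InCone w) (hw' : InCone w') (l₁ l₂ l₃ : ℕ) (h₁ : 1 ≤ l₁)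
    (h₂ : 1 ≤ l₂) (h₃ : 1 ≤ l₃) :
    K4v (thetaCyc ((2 : ℝ) ^ l₁ - 2) ((2 : ℝ) ^ l₂ - 2) ((2 : ℝ) ^ l₃ - 2) w w') :=
  K4v_thetaCyc_of_InCone hw hw' (mixed_mult_nonneg l₁ h₁) (mixed_mult_nonneg l₂ h₂) (mixed_mult_nonneg l₃ h₃)


/-- The cycle's output is relaxed-feasible for cone inputs: (P) and the trivial bounds — so a cycle can sit below a
triangle (`K4v_thetaTri_of_rel`). -/
theorem Rel_thetaCyc_of_InCone {w w' : Vec6} (hw : InCone w) (hw' : InCone w') {p q s : ℝ} (hp : 0 ≤ p)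
    (hq : 0 ≤ q) (hs : 0 ≤ s) : Rel (thetaCyc p q s w w') := by
  rw [thetaCyc_eq]
  have h1 : Rel (thetaTri w w') := Rel_thetaTri_of_rel (Rel_of_InCone hw) (Rel_of_InCone hw')
  have h2 : InCone (ellv (ellv w * w')) := InCone_ellv ((InCone_ellv hw).mul hw')
  have h3 : InCone (ellv (w * ellv w')) := InCone_ellv (hw.mul (InCone_ellv hw'))
  have hn : 0 ≤ nAdm w := nAdm_nonneg_of_K4v (K4v_of_InCone hw)
  have hn' : 0 ≤ nAdm w' := nAdm_nonneg_of_K4v (K4v_of_InCone hw')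
  have hnn : 0 ≤ nAdm (w * w') := nAdm_nonneg_of_K4v (K4v_of_InCone (hw.mul hw'))
  have h4 : InCone ((p * s * (nAdm w * nAdm w' + nAdm (w * w'))) • (1 : Vec6)) :=
    InCone.smul _ (mul_nonneg (mul_nonneg hp hs) (add_nonneg (mul_nonneg hn hn') hnn)) InCone_one
  have h5 : InCone ((ellv w + (p * nAdm w) • (1 : Vec6)) * (ellv w' + (s * nAdm w') • (1 : Vec6))) :=
    ((InCone_ellv hw).add (InCone.smul _ (mul_nonneg hp hn) InCone_one)).mul
      ((InCone_ellv hw').add (InCone.smul _ (mul_nonneg hs hn') InCone_one))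
  exact Rel_add (Rel_add (Rel_add (Rel_add h1 (Rel_smul (Rel_of_InCone h2) hp))
    (Rel_smul (Rel_of_InCone h3) hs)) (Rel_of_InCone h4)) (Rel_smul (Rel_of_InCone h5) hq)

/-- A cone-member output feeds a further cycle: two nested two-exit cycles with (1,1)-marked vertices at the leaves
satisfy (P). -/
theorem K4v_thetaCyc_nested_X11 {p q s p' q' s' p'' q'' s'' : ℝ} (hp : 0 ≤ p) (hq : 0 ≤ q) (hs : 0 ≤ s)
    (hp' : 0 ≤ p') (hq' : 0 ≤ q') (hs' : 0 ≤ s') (hp'' : 0 ≤ p'') (hq'' : 0 ≤ q'') (hs'' : 0 ≤ s'') :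
    K4v (thetaCyc p q s (thetaCyc p' q' s' (v 1 * v 0) (v 1 * v 0)) (thetaCyc p'' q'' s'' (v 1 * v 0) (v 1 * v 0))) :=
  K4v_thetaCyc_of_InCone (InCone_thetaCyc_X11_X11 hp' hq' hs') (InCone_thetaCyc_X11_X11 hp'' hq'' hs'') hp hq hs

end RelaxedTriangle

end PercRepro
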